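import Mathlib
import HarnessLib
import Summits.CriticalPhenomena.CardyFormulaZ2.Theorems.CardyMagicRigidityMagicFormulaTHexCells
import Summits.CriticalPhenomena.CardyFormulaZ2.Theorems.CardyMagicRigidityMagicFormulaTStubCellBridge
import Summits.CriticalPhenomena.CardyFormulaZ2.Theorems.CardyMagicRigidityMagicFormulaTLogKernel
import Summits.CriticalPhenomena.CardyFormulaZ2.Theorems.CardyMagicRigidityNestingRigidityShellPotential

/-!
# The dilation identity of the logarithmic energy and the Coulomb majorant
# (line `Sketch`, stub `stub_riemannLog`, 2)

Crux `Summit.CriticalPhenomena.CardyFormulaZ2.Theses.CardyMagicRigidity.MagicFormulaT`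
(stmt-CriticalPhenomena-4836), line `Sketch` (card `kac-window-vertex-operators`), stub
`stub_riemannLog` of the registered skeleton `Cruxes/MagicFormulaT/Lines/Sketch.lean`; this
helper file is registered on the crux as the sub-goal `riemannLog_energyDilation` (its last
theorem).  Tree vocabulary only (the open Voronoi hexagon `H_x` of the unit lattice is a local
notation, as in `…MagicFormulaTHexCells`).

* **The Coulomb majorant** (`abs_logCoeff_sub_log_le`): for `w ∈ H_x`, `w' ∈ H_y`,
  `|ℓ̃_{xy} − log‖w − w'‖| ≤ 80/‖w − w'‖`, where `ℓ̃_{xy} = log‖x − y‖` (`x ≠ y`), `0` (`x = y`):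
  far pairs (`‖x − y‖ > 4`) by `log s ≤ s − 1` (`|log d − log r| ≤ 3/r` for `|r − d| ≤ 2`),
  near pairs and the diagonal crudely by `|log t| ≤ t + t⁻¹` and `‖x − y‖ ≥ 1/√6` for distinct
  sites (the site `y` is not in the cell of `x`; `‖v‖² = Σ μ_i(v)²/6`, `norm_sq_eq_hform`);
* **the exact dilation identity** (registered sub-goal `riemannLog_energyDilation`): for
  admissible neutral `f` and `δ > 0`, with `f_δ = δ² f(δ ·)`,
  `∫∫ log‖w − w'‖ f_δ(w) f_δ(w') dw' dw = ∫∫ log‖x − y‖ f(x) f(y) dy dx` — the substitutions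
  `w' = y/δ`, `w = x/δ` (`Measure.integral_comp_smul`, `finrank ℝ ℂ = 2`) leave
  `log‖x − y‖ − log δ` (for `y ≠ x`, i.e. almost everywhere), and neutrality `∫ f = 0` kills
  `log δ` inside the (integrable, `integrable_kernel_mul`) inner integral.

Folklore; no named facts are used.
-/

noncomputable section

namespace Summit.CriticalPhenomena.CardyFormulaZ2.Cruxes.MagicFormulaT.LineSketch

open MeasureTheory Filter Finset Set Metric
open scoped Real Topology BigOperators
open Literature.Probability.RandomPlanarGeometry Literature.Probability.Percolation
  Literature.Probability.LatticeModels
open Summit.CriticalPhenomena.CardyFormulaZ2.Cruxes.NestingRigidity.RingCloudTomography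
  (integrableOn_log_norm_ball)

/-- The open Voronoi hexagon of the site `x` of the unit lattice (local notation, not a definition:
the stub is stated with this set written inline). -/
local notation3 (prettyPrint := false) "𝓗[" x "]" =>
  {z : ℂ | ∀ i : Fin 3, |hform i (z - triMeshPoint 1 x)| < 1}

/-! ## The Coulomb majorant of the kernel error on pairs of cells -/

section Majorant

/-- Far pairs: for `d > 4` and `|r − d| ≤ 2`, `|log d − log r| ≤ 3/r` (`log s ≤ s − 1` at
`s = r/d` and `s = d/r`). -/
theorem abs_log_sub_log_le_of_far {d r : ℝ} (hd : 4 < d) (h1 : d - 2 ≤ r) (h2 : r ≤ d + 2) :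
    |Real.log d - Real.log r| ≤ 3 * r⁻¹ := by
  have hd0 : 0 < d := by linarith
  have hr : 0 < r := by linarith
  have hi := Real.log_le_sub_one_of_pos (div_pos hr hd0)
  have hii := Real.log_le_sub_one_of_pos (div_pos hd0 hr)
  rw [Real.log_div hr.ne' hd0.ne'] at hi
  rw [Real.log_div hd0.ne' hr.ne'] at hii
  have k1 : r / d - 1 ≤ 3 * r⁻¹ := by
    rw [div_sub_one hd0.ne', inv_eq_one_div, mul_one_div, div_le_div_iff₀ hd0 hr]
    nlinarith
  have k2 : d / r - 1 ≤ 3 * r⁻¹ := by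
    rw [div_sub_one hr.ne', inv_eq_one_div, mul_one_div, div_le_div_iff₀ hr hr]
    nlinarith
  rw [abs_le]
  constructor <;> linarith

/-- Near pairs: for `0 < d ≤ 4` with `d⁻¹ ≤ 3` and `0 < r ≤ d + 2`, `|log d − log r| ≤ 79/r`. -/
theorem abs_log_sub_log_le_of_near {d r : ℝ} (hd0 : 0 < d) (hdi : d⁻¹ ≤ 3) (hd4 : d ≤ 4)
    (hr : 0 < r) (h2 : r ≤ d + 2) : |Real.log d - Real.log r| ≤ 79 * r⁻¹ := by
  have hd' := abs_log_le_add_inv hd0.le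
  have hr' := abs_log_le_add_inv hr.le
  have h13 : (13 : ℝ) ≤ 78 * r⁻¹ := by
    rw [le_mul_inv_iff₀ hr]
    linarith
  calc |Real.log d - Real.log r| ≤ |Real.log d| + |Real.log r| := abs_sub _ _
    _ ≤ 79 * r⁻¹ := by linarith

/-- The diagonal: for `0 ≤ r ≤ 2`, `|log r| ≤ 80/r` (junk conventions at `r = 0`). -/
theorem abs_log_le_of_le_two {r : ℝ} (hr0 : 0 ≤ r) (hr2 : r ≤ 2) : |Real.log r| ≤ 80 * r⁻¹ := by
  rcases hr0.eq_or_lt with hr | hr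
  · subst hr; simp
  · have h := abs_log_le_add_inv hr.le
    have h' : r ≤ 79 * r⁻¹ := by
      rw [le_mul_inv_iff₀ hr]
      nlinarith
    linarith

/-- **Distinct sites are at distance `≥ 1/√6`**: `0 < ‖x − y‖` and `‖x − y‖⁻¹ ≤ 3` for `x ≠ y`
(the site `y` is not in the cell of `x`, so one hex form of `y − x` is `≥ 1` in absolute value,
and `‖v‖² = Σ μ_i(v)²/6`). -/
theorem norm_triMeshPoint_sub_pos_and_inv_le {x y : Site 2} (hxy : x ≠ y) :
    0 < ‖triMeshPoint 1 x - triMeshPoint 1 y‖ ∧ ‖triMeshPoint 1 x - triMeshPoint 1 y‖⁻¹ ≤ 3 := by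
  have hy : triMeshPoint 1 y ∉ 𝓗[x] :=
    Set.disjoint_right.1 (disjoint_hexCell hxy) (triMeshPoint_mem_hexCell y)
  simp only [mem_setOf_eq, not_forall, not_lt] at hy
  obtain ⟨i, hi⟩ := hy
  have hsq : (1 : ℝ) / 6 ≤ ‖triMeshPoint 1 x - triMeshPoint 1 y‖ ^ 2 := by
    rw [norm_sub_rev, norm_sq_eq_hform]
    have h1 : 1 ≤ hform i (triMeshPoint 1 y - triMeshPoint 1 x) ^ 2 :=
      (one_le_sq_iff_one_le_abs _).2 hi
    have s0 := sq_nonneg (hform 0 (triMeshPoint 1 y - triMeshPoint 1 x))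
    have s1 := sq_nonneg (hform 1 (triMeshPoint 1 y - triMeshPoint 1 x))
    have s2 := sq_nonneg (hform 2 (triMeshPoint 1 y - triMeshPoint 1 x))
    fin_cases i <;> simp only [Fin.zero_eta, Fin.mk_one, Fin.reduceFinMk] at h1 <;> linarith
  set d := ‖triMeshPoint 1 x - triMeshPoint 1 y‖ with hd
  have hd0 : 0 ≤ d := norm_nonneg _
  have hdpos : 0 < d := by
    by_contra h
    have : d = 0 := le_antisymm (not_lt.1 h) hd0
    rw [this] at hsq
    norm_num at hsq
  refine ⟨hdpos, ?_⟩
  rw [inv_le_comm₀ hdpos (by norm_num : (0 : ℝ) < 3)]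
  nlinarith

/-- **The Coulomb majorant**: for `w ∈ H_x`, `w' ∈ H_y`,
`|ℓ̃_{xy} − log‖w − w'‖| ≤ 80/‖w − w'‖`, where `ℓ̃_{xy} = log‖x − y‖` for `x ≠ y` and `0` for
`x = y` (far pairs by `abs_log_sub_log_le_of_far`, near pairs and the diagonal crudely). -/
theorem abs_logCoeff_sub_log_le (x y : Site 2) {w w' : ℂ} (hw : w ∈ 𝓗[x]) (hw' : w' ∈ 𝓗[y]) :
    |(if x = y then 0 else Real.log ‖triMeshPoint 1 x - triMeshPoint 1 y‖) - Real.log ‖w - w'‖|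
      ≤ 80 * ‖w - w'‖⁻¹ := by
  have h1 : ‖w - triMeshPoint 1 x‖ < 1 := norm_sub_lt_one_of_mem_hexCell hw
  have h2 : ‖w' - triMeshPoint 1 y‖ < 1 := norm_sub_lt_one_of_mem_hexCell hw'
  split_ifs with hxy
  · subst hxy
    rw [zero_sub, abs_neg]
    refine abs_log_le_of_le_two (norm_nonneg _) ?_
    calc ‖w - w'‖ = ‖(w - triMeshPoint 1 x) - (w' - triMeshPoint 1 x)‖ := by ring_nf
      _ ≤ ‖w - triMeshPoint 1 x‖ + ‖w' - triMeshPoint 1 x‖ := norm_sub_le _ _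
      _ ≤ 2 := by linarith
  · obtain ⟨hdpos, hdi⟩ := norm_triMeshPoint_sub_pos_and_inv_le hxy
    set d := ‖triMeshPoint 1 x - triMeshPoint 1 y‖ with hd
    set r := ‖w - w'‖ with hr
    have hrd : |r - d| ≤ 2 := by
      have h := abs_norm_sub_norm_le (w - w') (triMeshPoint 1 x - triMeshPoint 1 y)
      have e : w - w' - (triMeshPoint 1 x - triMeshPoint 1 y) =
          (w - triMeshPoint 1 x) - (w' - triMeshPoint 1 y) := by ring
      rw [e] at h
      have h' := norm_sub_le (w - triMeshPoint 1 x) (w' - triMeshPoint 1 y)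
      rw [hr, hd]
      linarith
    have hrpos : 0 < r := by
      rw [hr, norm_pos_iff, sub_ne_zero]
      rintro rfl
      exact Set.disjoint_left.1 (disjoint_hexCell hxy) hw hw'
    rw [abs_le] at hrd
    have hri : 0 ≤ r⁻¹ := inv_nonneg.2 hrpos.le
    rcases lt_or_ge 4 d with hd4 | hd4
    · have := abs_log_sub_log_le_of_far (r := r) hd4 (by linarith) (by linarith)
      linarith
    · have := abs_log_sub_log_le_of_near hdpos hdi hd4 hrpos (by linarith)
      linarith

end Majorant

/-! ## The exact dilation identity of the energy -/

section Scaling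

variable {f : ℂ → ℝ} {R C : ℝ}

/-- Inner change of variables `w' = y/δ`:
`∫ log‖w − w'‖ f(δ w') dw' = δ⁻² ∫ log‖w − y/δ‖ f(y) dy`. -/
theorem integral_log_mul_dilate (f : ℂ → ℝ) {δ : ℝ} (hδ : 0 < δ) (w : ℂ) :
    ∫ w', Real.log ‖w - w'‖ * f ((δ : ℂ) * w') =
      (δ ^ 2)⁻¹ * ∫ y, Real.log ‖w - (δ : ℂ)⁻¹ * y‖ * f y := by
  have h := Measure.integral_comp_smul volume (fun y : ℂ ↦ Real.log ‖w - (δ : ℂ)⁻¹ * y‖ * f y) δ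
  simp only [Complex.real_smul, Complex.finrank_real_complex] at h
  have hδ' : (δ : ℂ) ≠ 0 := Complex.ofReal_ne_zero.2 hδ.ne'
  simp only [← mul_assoc, inv_mul_cancel₀ hδ', one_mul] at h
  rw [h, smul_eq_mul, abs_of_pos (by positivity)]

/-- **Neutrality kills `log δ`**: `∫ log‖x/δ − y/δ‖ f(y) dy = ∫ log‖x − y‖ f(y) dy` when `∫ f = 0`
(`log‖x/δ − y/δ‖ = log δ⁻¹ + log‖x − y‖` for `y ≠ x`, i.e. almost everywhere, and the inner
integrand `log‖x − ·‖ f` is integrable). -/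
theorem integral_log_norm_inv_mul_sub (hf : Measurable f) (hC : ∀ z, |f z| ≤ C)
    (hR : ∀ z, R < ‖z‖ → f z = 0) (h0 : ∫ z, f z = 0) {δ : ℝ} (hδ : 0 < δ) (x : ℂ) :
    ∫ y, Real.log ‖(δ : ℂ)⁻¹ * x - (δ : ℂ)⁻¹ * y‖ * f y = ∫ y, Real.log ‖x - y‖ * f y := by
  have hae : ∀ᵐ y ∂(volume : Measure ℂ), y ≠ x := by
    rw [ae_iff]
    simp
  have h1 : (fun y ↦ Real.log ‖(δ : ℂ)⁻¹ * x - (δ : ℂ)⁻¹ * y‖ * f y) =ᵐ[volume]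
      fun y ↦ Real.log δ⁻¹ * f y + Real.log ‖x - y‖ * f y := by
    filter_upwards [hae] with y hy
    rw [← mul_sub, norm_mul, norm_inv, Complex.norm_real, Real.norm_eq_abs, abs_of_pos hδ,
      Real.log_mul (inv_ne_zero hδ.ne') (norm_ne_zero_iff.2 (sub_ne_zero.2 (Ne.symm hy))),
      add_mul]
  rw [integral_congr_ae h1, integral_add, integral_const_mul, h0, mul_zero, zero_add]
  · exact (integrable_of_bdd_of_supp hf hC hR).const_mul _
  · exact integrable_kernel_mul (κ := Real.log) (fun r ↦ integrableOn_log_norm_ball r) hf hC hR x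

/-- **Sub-goal `riemannLog_energyDilation` of stub `stub_riemannLog`: the exact dilation
identity of the logarithmic energy.**  For admissible neutral `f` and `δ > 0`, with
`f_δ = δ² f(δ ·)`: `∫∫ log‖w − w′‖ f_δ(w) f_δ(w′) dw′ dw = ∫∫ log‖x − y‖ f(x) f(y) dy dx`. -/
theorem riemannLog_energyDilation : ∀ (f : ℂ → ℝ) (R C δ : ℝ), Measurable f →
    (∀ z, |f z| ≤ C) → (∀ z, R < ‖z‖ → f z = 0) → ∫ z, f z = 0 → 0 < δ →
    ∫ w, ∫ w', Real.log ‖w - w'‖ * (δ ^ 2 * f ((δ : ℂ) * w)) * (δ ^ 2 * f ((δ : ℂ) * w')) =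
      ∫ x, ∫ y, Real.log ‖x - y‖ * f x * f y := by
  intro f R C δ hf hC hR h0 hδ
  -- inner substitution `w' = y/δ`
  have hinner : ∀ w, ∫ w', Real.log ‖w - w'‖ * (δ ^ 2 * f ((δ : ℂ) * w)) *
      (δ ^ 2 * f ((δ : ℂ) * w')) =
      δ ^ 2 * f ((δ : ℂ) * w) * ∫ y, Real.log ‖w - (δ : ℂ)⁻¹ * y‖ * f y := by
    intro w
    have h1 : ∫ w', Real.log ‖w - w'‖ * (δ ^ 2 * f ((δ : ℂ) * w)) * (δ ^ 2 * f ((δ : ℂ) * w')) =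
        δ ^ 2 * f ((δ : ℂ) * w) * δ ^ 2 * ∫ w', Real.log ‖w - w'‖ * f ((δ : ℂ) * w') := by
      rw [← integral_const_mul]
      refine integral_congr_ae (ae_of_all _ fun w' ↦ ?_)
      ring
    rw [h1, integral_log_mul_dilate f hδ w]
    field_simp
  simp_rw [hinner]
  -- outer substitution `w = x/δ`
  have hδ' : (δ : ℂ) ≠ 0 := Complex.ofReal_ne_zero.2 hδ.ne'
  have h2 := Measure.integral_comp_smul volume
    (fun x : ℂ ↦ δ ^ 2 * f x * ∫ y, Real.log ‖(δ : ℂ)⁻¹ * x - (δ : ℂ)⁻¹ * y‖ * f y) δ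
  simp only [Complex.real_smul, Complex.finrank_real_complex, ← mul_assoc,
    inv_mul_cancel₀ hδ', one_mul] at h2
  rw [h2, smul_eq_mul, abs_of_pos (by positivity)]
  -- neutrality, and reassembly of the integrand
  simp_rw [integral_log_norm_inv_mul_sub hf hC hR h0 hδ]
  rw [← integral_const_mul]
  refine integral_congr_ae (ae_of_all _ fun x ↦ ?_)
  dsimp only
  rw [← mul_assoc, ← mul_assoc, inv_mul_cancel₀ (by positivity : (δ ^ 2 : ℝ) ≠ 0), one_mul,
    ← integral_const_mul]
  refine integral_congr_ae (ae_of_all _ fun y ↦ ?_)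
  dsimp only
  ring

end Scaling

end Summit.CriticalPhenomena.CardyFormulaZ2.Cruxes.MagicFormulaT.LineSketch

end
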